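import Literature.Analysis.FluidPDE.OseenSlice
import Literature.Analysis.UnboundedOperators.HeatExtensionJointSmooth
import HarnessLib

/-!
# The Oseen–Koch–Tataru kernel is jointly smooth in `(σ, z)`, with Gaussian-potential bounds

Analysis/FluidPDE support file (everything proved) on the discharge path of the named fact
`Literature.Analysis.FluidPDE.knss2009_local_smoothing` (`NSBoundedMildSmoothing.lean`;
Koch–Nadirashvili–Seregin–Šverák 2009, Prop. 4.1). The local smoothing theory differentiates the
Duhamel term `B^ν_s(u,v)(t)(x) = ∫ₛᵗ∫ K(ν(t-τ), x-y)[u(τ,y), v(τ,y)] dy dτ` in `(t, x)` jointly,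
the derivatives falling on the kernel `K(σ, z)[a, b] = oseenKernel σ z a b` (`KochTataru.lean`,
Koch–Tataru 2001, (8); as a continuous bilinear map, `oseenKernelCLM σ z`, `OseenSlice.lean`) near
the initial time; this needs `K` to be **jointly `C^∞` in `(σ, z)` on `(0, ∞) × E` with
integrable control of all its joint derivatives**. Both follow from the semigroup law
`e^{tΔ}K(σ)[a,b] = K(σ + t)[a,b]` (`heatExtension_oseenKernel`, `OseenKernelSemigroup.lean`), which
makes `(σ, z) ↦ K(σ, z)[a, b]` on `(σ₁, ∞) × E` the time translate of the caloric extension of the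
bounded datum `K(σ₁, ·)[a, b]`, and the joint smoothness of caloric extensions
(`HeatExtensionJointSmooth.lean`). (The vector-valued slices `K(·,·)[a,b]` are used rather than the
operator-valued kernel as a Banach datum, the operator-valued statements being recovered by
`contDiffOn_clm_apply` and operator-norm bounds.)

* `contDiffOn_oseenKernel_prod`, `contDiffOn_oseenKernelCLM_prod`: `(σ, z) ↦ K(σ, z)[a, b]` and
  `(σ, z) ↦ K(σ, z)` are `C^∞` on `(0, ∞) × E`;
* `exists_norm_iteratedFDeriv_oseenKernel_prod_le`: on a compact range `[σ_a, σ_b] ⊂ (0, ∞)`,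
  `‖D^m_{(σ,z)} (K(·,·)[a,b])(σ, z)‖ ≤ C ‖a‖ ‖b‖ P(z)` with the **Gaussian potential**
  `P(z) = oseenKernelPotential (σ_a/2) (8t₁) z = ∫ e^{-‖z-y‖²/(8t₁)} (σ_a/2 + ‖y‖²)^{-(d+1)/2} dy`,
  `t₁ = σ_b - σ_a/2`, of the integrable parabolic envelope of Koch–Tataru's bound (14) at time
  `σ_a/2`; the same for the operator-valued derivative
  (`exists_norm_iteratedFDeriv_oseenKernelCLM_prod_le`), whence the uniform bound
  (`…_le_const`), the `L¹` bound in `z` (`exists_integral_norm_iteratedFDeriv_oseenKernelCLM_prod_le`),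
  the integrability of the potential (`integrable_oseenKernelPotential`) and its unit-ball
  envelopes `P_c(z + e) ≤ e^{2/c} P_{2c}(z)` (`oseenKernelPotential_add_le`) — the dominating
  functions of the derivatives of the Duhamel term.

KNSS 2009, §3 p. 6 and Remark 4.2: the kernel of `e^{σΔ}P∇·` has the smoothing properties of
`∇G_σ` ("a routine inspection of the representation formula").

## References

* G. Koch, N. Nadirashvili, G. Seregin, V. Šverák, Acta Math. 203 (2009) = arXiv:0709.3599,
  §3 p. 6 ((3.4)–(3.6)), §4 Prop. 4.1, Remark 4.2. [KochNadirashviliSereginSverak2009]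
* H. Koch, D. Tataru, Adv. Math. 157 (2001), §2 (5)–(8), §3 (14). [KochTataruAdvMath2001]
-/

noncomputable section

open MeasureTheory Set Function Filter Metric Real
open _root_.Topology
open scoped ENNReal NNReal RealInnerProductSpace ContDiff Convolution

namespace Literature.Analysis.FluidPDE

open UnboundedOperators (heatKernel heatExtension)

variable {E : Type*} [NormedAddCommGroup E] [InnerProductSpace ℝ E] [FiniteDimensional ℝ E]
  [MeasurableSpace E] [BorelSpace E]

/-! ### The vector-valued slices `z ↦ K(σ, z)[a, b]` as caloric data -/

section Datum

/-- `z ↦ K(σ, z)[a, b]` is in `L^∞` for `σ > 0` (Koch–Tataru's bound (14)). [cite: KochTataruAdvMath2001, §3 (14)] -/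
theorem memLp_top_oseenKernel_slice {σ : ℝ} (hσ : 0 < σ) (a b : E) :
    MemLp (fun z : E => oseenKernel σ z a b) ∞ volume := by
  obtain ⟨C, hC, hK⟩ := exists_norm_oseenKernel_le (E := E)
  refine memLp_top_of_bound (continuous_oseenKernel hσ a b).aestronglyMeasurable
    (C * σ ^ (-(((Module.finrank ℝ E : ℝ) + 1) / 2)) * ‖a‖ * ‖b‖) (Eventually.of_forall fun z => ?_)
  refine (hK hσ z a b).trans ?_
  have hrp : (σ + ‖z‖ ^ 2) ^ (-(((Module.finrank ℝ E : ℝ) + 1) / 2)) ≤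
      σ ^ (-(((Module.finrank ℝ E : ℝ) + 1) / 2)) :=
    Real.rpow_le_rpow_of_nonpos hσ (le_add_of_nonneg_right (sq_nonneg _)) (neg_nonpos.2 (by positivity))
  gcongr

/-- On `(σ₁, ∞)` the slice is the caloric extension of the slice at `σ₁`, translated in time
(`heatExtension_oseenKernel`). [folklore] -/
theorem oseenKernel_eq_heatExtension_of_lt {σ₁ : ℝ} (hσ₁ : 0 < σ₁) (a b : E) {q : ℝ × E}
    (hq : σ₁ < q.1) :
    oseenKernel q.1 q.2 a b = heatExtension (fun z : E => oseenKernel σ₁ z a b) (q.1 - σ₁) q.2 := by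
  rw [heatExtension_oseenKernel hσ₁ (sub_pos.2 hq) a b q.2, add_sub_cancel]

end Datum

/-! ### Joint smoothness -/

section Smooth

/-- **The slices `(σ, z) ↦ K(σ, z)[a, b]` are jointly `C^∞` on `(0, ∞) × E`** (KNSS 2009, §3
p. 6 and Remark 4.2: the kernel of `e^{σΔ}P∇·` smooths like the heat kernel): by the semigroup
law the slice is, near every point, a time translate of the caloric extension of a bounded datum
(`contDiffOn_heatExtension_prod`). [cite: KochNadirashviliSereginSverak2009, §3 p. 6 and Remark 4.2 (arXiv:0709.3599)] -/
theorem contDiffOn_oseenKernel_prod (a b : E) :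
    ContDiffOn ℝ ∞ (fun q : ℝ × E => oseenKernel q.1 q.2 a b) (Ioi 0 ×ˢ univ) := by
  refine contDiffOn_of_locally_contDiffOn fun q hq => ?_
  have hq1 : 0 < q.1 := (mem_prod.1 hq).1
  have hσ₁0 : 0 < q.1 / 2 := half_pos hq1
  have hmem : q ∈ Ioi (q.1 / 2) ×ˢ (univ : Set E) := mk_mem_prod (half_lt_self hq1) (mem_univ _)
  refine ⟨Ioi (q.1 / 2) ×ˢ univ, isOpen_Ioi.prod isOpen_univ, hmem, ?_⟩
  have hsm := UnboundedOperators.contDiffOn_heatExtension_prod (memLp_top_oseenKernel_slice hσ₁0 a b)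
    le_top
  have hmap : ContDiffOn ℝ ∞ (fun r : ℝ × E => ((r.1 - q.1 / 2, r.2) : ℝ × E)) (Ioi (q.1 / 2) ×ˢ univ) :=
    ((contDiff_fst.sub contDiff_const).prodMk contDiff_snd).contDiffOn
  have hcomp : ContDiffOn ℝ ∞ (fun r : ℝ × E =>
      heatExtension (fun z : E => oseenKernel (q.1 / 2) z a b) (r.1 - q.1 / 2) r.2)
      (Ioi (q.1 / 2) ×ˢ univ) :=
    hsm.comp hmap fun r hr =>
      mk_mem_prod (mem_Ioi.2 (sub_pos.2 (mem_prod.1 hr).1)) (mem_univ _)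
  refine (hcomp.mono inter_subset_right).congr fun r hr => ?_
  exact oseenKernel_eq_heatExtension_of_lt hσ₁0 a b (mem_prod.1 hr.2).1

/-- **The operator-valued kernel `(σ, z) ↦ K(σ, z)` is jointly `C^∞` on `(0, ∞) × E`**
(componentwise, `contDiffOn_clm_apply`). [cite: KochNadirashviliSereginSverak2009, §3 p. 6 and Remark 4.2 (arXiv:0709.3599)] -/
theorem contDiffOn_oseenKernelCLM_prod :
    ContDiffOn ℝ ∞ (fun q : ℝ × E => oseenKernelCLM q.1 q.2) (Ioi 0 ×ˢ univ) := by
  refine contDiffOn_clm_apply.2 fun a => contDiffOn_clm_apply.2 fun b => ?_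
  simp only [oseenKernelCLM_apply]
  exact contDiffOn_oseenKernel_prod a b

/-- Smoothness at every point of the half-space. [folklore] -/
theorem contDiffAt_oseenKernelCLM_prod {q : ℝ × E} (hq : q ∈ Ioi (0 : ℝ) ×ˢ (univ : Set E)) :
    ContDiffAt ℝ ∞ (fun r : ℝ × E => oseenKernelCLM r.1 r.2) q :=
  contDiffOn_oseenKernelCLM_prod.contDiffAt ((isOpen_Ioi.prod isOpen_univ).mem_nhds hq)

/-- Continuity of the joint derivatives of the operator-valued kernel on the half-space.
[folklore] -/
theorem continuousOn_iteratedFDeriv_oseenKernelCLM_prod (m : ℕ) :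
    ContinuousOn (fun q : ℝ × E => iteratedFDeriv ℝ m (fun r : ℝ × E => oseenKernelCLM r.1 r.2) q)
      (Ioi 0 ×ˢ univ) := by
  have hopen : IsOpen (Ioi (0 : ℝ) ×ˢ (univ : Set E)) := isOpen_Ioi.prod isOpen_univ
  have h := contDiffOn_oseenKernelCLM_prod (E := E) |>.continuousOn_iteratedFDerivWithin (m := m)
    (by exact_mod_cast le_top) hopen.uniqueDiffOn
  exact h.congr fun p hp => (iteratedFDerivWithin_of_isOpen m hopen hp).symm

/-- **Evaluation commutes with the joint derivatives**:
`(D^m K)(q)[V](a)(b) = D^m (K(·,·)[a,b])(q)[V]` on the half-space. [folklore] -/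
theorem iteratedFDeriv_oseenKernelCLM_prod_apply (m : ℕ) {q : ℝ × E}
    (hq : q ∈ Ioi (0 : ℝ) ×ˢ (univ : Set E)) (V : Fin m → ℝ × E) (a b : E) :
    iteratedFDeriv ℝ m (fun r : ℝ × E => oseenKernelCLM r.1 r.2) q V a b =
      iteratedFDeriv ℝ m (fun r : ℝ × E => oseenKernel r.1 r.2 a b) q V := by
  set L : (E →L[ℝ] E →L[ℝ] E) →L[ℝ] E :=
    (ContinuousLinearMap.apply ℝ E b).comp (ContinuousLinearMap.apply ℝ (E →L[ℝ] E) a) with hL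
  have hcomp : (fun r : ℝ × E => oseenKernel r.1 r.2 a b) = L ∘ fun r : ℝ × E => oseenKernelCLM r.1 r.2 := by
    funext r
    simp [hL]
  rw [hcomp, L.iteratedFDeriv_comp_left (contDiffAt_oseenKernelCLM_prod hq) (i := m)
    (by exact_mod_cast le_top)]
  simp [hL]

end Smooth

/-! ### Gaussian-potential bounds for the joint derivatives on compact time ranges -/

section Bounds

/-- **The joint derivatives of a slice are those of a caloric extension**: for `0 < σ₁ < σ`,
`D^m_{(σ,z)} (K(·,·)[a,b])(σ, z) = D^m_{(t,z)} [e^{tΔ}K(σ₁,·)[a,b]](σ - σ₁, z)`. [folklore] -/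
theorem iteratedFDeriv_oseenKernel_prod_eq {σ₁ : ℝ} (hσ₁ : 0 < σ₁) (a b : E) (m : ℕ) {σ : ℝ}
    (hσ : σ₁ < σ) (z : E) :
    iteratedFDeriv ℝ m (fun r : ℝ × E => oseenKernel r.1 r.2 a b) (σ, z) =
      iteratedFDeriv ℝ m (fun r : ℝ × E =>
        heatExtension (fun y : E => oseenKernel σ₁ y a b) r.1 r.2) (σ - σ₁, z) := by
  have hev : (fun r : ℝ × E => oseenKernel r.1 r.2 a b) =ᶠ[𝓝 ((σ, z) : ℝ × E)]
      fun r : ℝ × E => (fun r' : ℝ × E =>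
        heatExtension (fun y : E => oseenKernel σ₁ y a b) r'.1 r'.2) (r - ((σ₁, 0) : ℝ × E)) := by
    refine eventually_of_mem ((isOpen_Ioi.prod isOpen_univ).mem_nhds
      (mk_mem_prod (show σ ∈ Ioi σ₁ from hσ) (mem_univ z))) fun r hr => ?_
    dsimp only
    rw [oseenKernel_eq_heatExtension_of_lt hσ₁ a b (mem_prod.1 hr).1]
    simp
  rw [(hev.iteratedFDeriv ℝ m).eq_of_nhds,
    iteratedFDeriv_comp_sub (f := fun r' : ℝ × E =>
      heatExtension (fun y : E => oseenKernel σ₁ y a b) r'.1 r'.2) m ((σ₁, (0 : E)) : ℝ × E) (σ, z)]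
  simp

/-- Gaussians with variance parameter `c > 0` are integrable: `∫ e^{-‖w‖²/c} dw < ∞`. [folklore] -/
theorem integrable_exp_neg_norm_sq_div {c : ℝ} (hc : 0 < c) :
    Integrable (fun w : E => Real.exp (-‖w‖ ^ 2 / c)) := by
  have h := UnboundedOperators.integrable_gaussian_of_pos (E := E) (inv_pos.2 hc)
  refine h.congr (Eventually.of_forall fun w => ?_)
  show Real.exp (-c⁻¹ * ‖w‖ ^ 2) = Real.exp (-‖w‖ ^ 2 / c)
  congr 1
  ring

/-- Translated Gaussians times the norm of an `L¹` function are integrable. [folklore] -/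
theorem integrable_exp_neg_norm_sub_sq_div_mul {F : Type*} [NormedAddCommGroup F] {g : E → F}
    (hg : Integrable g) {c : ℝ} (hc : 0 < c) (z : E) :
    Integrable (fun y : E => Real.exp (-‖z - y‖ ^ 2 / c) * ‖g y‖) := by
  have h := UnboundedOperators.integrable_gaussian_smul_of_memLp (inv_pos.2 hc) z
    (memLp_one_iff_integrable.2 hg.norm) le_rfl
  refine h.congr (Eventually.of_forall fun y => ?_)
  show Real.exp (-c⁻¹ * ‖z - y‖ ^ 2) • ‖g y‖ = Real.exp (-‖z - y‖ ^ 2 / c) * ‖g y‖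
  rw [smul_eq_mul]
  congr 2
  ring

/-- **The kernel potential at time `σ₁`**: `P(z) = ∫ e^{-‖z-y‖²/c} (σ₁ + ‖y‖²)^{-(d+1)/2} dy`,
the Gaussian potential of the parabolic envelope of Koch–Tataru's bound (14) — the dominating
profile of all joint derivatives of the kernel on a time range (an integrable function of `z`,
`integrable_oseenKernelPotential`). [cite: KochTataruAdvMath2001, §3 (14)] -/
def oseenKernelPotential (σ₁ c : ℝ) (z : E) : ℝ :=
  ∫ y, Real.exp (-‖z - y‖ ^ 2 / c) * (σ₁ + ‖y‖ ^ 2) ^ (-(((Module.finrank ℝ E : ℝ) + 1) / 2))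

omit [FiniteDimensional ℝ E] [MeasurableSpace E] [BorelSpace E] in
/-- The parabolic envelope is bounded by its value at the origin: `(σ₁ + ‖y‖²)^{-(d+1)/2} ≤ σ₁^{-(d+1)/2}`.
[folklore] -/
theorem oseenEnvelope_le {σ₁ : ℝ} (hσ₁ : 0 < σ₁) (y : E) :
    (σ₁ + ‖y‖ ^ 2) ^ (-(((Module.finrank ℝ E : ℝ) + 1) / 2)) ≤ σ₁ ^ (-(((Module.finrank ℝ E : ℝ) + 1) / 2)) :=
  Real.rpow_le_rpow_of_nonpos hσ₁ (le_add_of_nonneg_right (sq_nonneg _)) (neg_nonpos.2 (by positivity))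

/-- The parabolic envelope is integrable (`σ₁ > 0`). [folklore] -/
theorem integrable_oseenEnvelope {σ₁ : ℝ} (hσ₁ : 0 < σ₁) :
    Integrable (fun y : E => (σ₁ + ‖y‖ ^ 2) ^ (-(((Module.finrank ℝ E : ℝ) + 1) / 2))) :=
  integrable_add_norm_sq_rpow_neg (by linarith) hσ₁

/-- The potential is nonnegative (`σ₁ ≥ 0`). [folklore] -/
theorem oseenKernelPotential_nonneg {σ₁ : ℝ} (hσ₁ : 0 ≤ σ₁) (c : ℝ) (z : E) :
    0 ≤ oseenKernelPotential σ₁ c z :=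
  integral_nonneg fun y => mul_nonneg (Real.exp_pos _).le (Real.rpow_nonneg (by positivity) _)

/-- The potential of the bounded envelope is bounded: `P(z) ≤ σ₁^{-(d+1)/2} ∫ e^{-‖w‖²/c} dw`.
[folklore] -/
theorem oseenKernelPotential_le {σ₁ c : ℝ} (hσ₁ : 0 < σ₁) (hc : 0 < c) (z : E) :
    oseenKernelPotential σ₁ c z ≤
      σ₁ ^ (-(((Module.finrank ℝ E : ℝ) + 1) / 2)) * ∫ w : E, Real.exp (-‖w‖ ^ 2 / c) := by
  have h := UnboundedOperators.integral_exp_mul_norm_le_of_ae_bound (E := E) (F := ℝ)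
    (f := fun y : E => (σ₁ + ‖y‖ ^ 2) ^ (-(((Module.finrank ℝ E : ℝ) + 1) / 2)))
    (M := σ₁ ^ (-(((Module.finrank ℝ E : ℝ) + 1) / 2)))
    (Eventually.of_forall fun y => by
      rw [Real.norm_of_nonneg (Real.rpow_nonneg (by positivity) _)]; exact oseenEnvelope_le hσ₁ y)
    (t₁ := c / 8) (by positivity) z
  have hc8 : 8 * (c / 8) = c := by ring
  simp only [hc8] at h
  refine le_trans (le_of_eq ?_) h
  refine integral_congr_ae (Eventually.of_forall fun y => ?_)
  dsimp only
  rw [Real.norm_of_nonneg (Real.rpow_nonneg (by positivity) _)]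

/-- **Gaussian-potential bound for the joint derivatives of the slices**: for every `m` and every
compact range `[σ_a, σ_b] ⊂ (0, ∞)` there is `C ≥ 0` with
`‖D^m_{(σ,z)} (K(·,·)[a,b])(σ, z)‖ ≤ C ‖a‖ ‖b‖ P(z)`, `P = oseenKernelPotential (σ_a/2) (8(σ_b - σ_a/2))`,
for all `σ ∈ [σ_a, σ_b]`, `z, a, b` (the bound of `HeatExtensionJointSmooth.lean` for the datum
`K(σ_a/2, ·)[a, b]`, which is dominated by `C₀ (σ_a/2 + ‖y‖²)^{-(d+1)/2} ‖a‖ ‖b‖`). KNSS 2009, §3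
p. 6: the kernel bounds behind (3.5)–(3.6). [cite: KochNadirashviliSereginSverak2009, §3 p. 6 and Remark 4.2 (arXiv:0709.3599)] -/
theorem exists_norm_iteratedFDeriv_oseenKernel_prod_le (m : ℕ) {σa σb : ℝ} (hσa : 0 < σa)
    (hab : σa ≤ σb) :
    ∃ C : ℝ, 0 ≤ C ∧ ∀ σ ∈ Icc σa σb, ∀ z a b : E,
      ‖iteratedFDeriv ℝ m (fun r : ℝ × E => oseenKernel r.1 r.2 a b) (σ, z)‖ ≤
        C * ‖a‖ * ‖b‖ * oseenKernelPotential (σa / 2) (8 * (σb - σa / 2)) z := by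
  have hσ₁ : 0 < σa / 2 := half_pos hσa
  have ht₀ : 0 < σa - σa / 2 := by linarith
  have h01 : σa - σa / 2 ≤ σb - σa / 2 := by linarith
  have ht₁ : 0 < σb - σa / 2 := ht₀.trans_le h01
  obtain ⟨C, hC, hb⟩ := UnboundedOperators.exists_norm_iteratedFDeriv_heatExtension_prod_le
    (E := E) (F := E) m ht₀ h01
  obtain ⟨C₀, hC₀, hK⟩ := exists_norm_oseenKernel_le (E := E)
  refine ⟨C * C₀, by positivity, fun σ hσ z a b => ?_⟩
  rw [iteratedFDeriv_oseenKernel_prod_eq hσ₁ a b m (by linarith [hσ.1]) z]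
  refine (hb (memLp_top_oseenKernel_slice hσ₁ a b) le_top (σ - σa / 2)
    ⟨by linarith [hσ.1], by linarith [hσ.2]⟩ z).trans ?_
  have hc : 0 < 8 * (σb - σa / 2) := by positivity
  have hint : Integrable (fun y : E => Real.exp (-‖z - y‖ ^ 2 / (8 * (σb - σa / 2))) *
      (C₀ * (σa / 2 + ‖y‖ ^ 2) ^ (-(((Module.finrank ℝ E : ℝ) + 1) / 2)) * ‖a‖ * ‖b‖)) := by
    have h := (integrable_exp_neg_norm_sub_sq_div_mul (integrable_oseenEnvelope (E := E) hσ₁) hc z).mul_const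
      (C₀ * ‖a‖ * ‖b‖)
    refine h.congr (Eventually.of_forall fun y => ?_)
    dsimp only
    rw [Real.norm_of_nonneg (Real.rpow_nonneg (by positivity) _)]
    ring
  calc C * ∫ y, Real.exp (-‖z - y‖ ^ 2 / (8 * (σb - σa / 2))) * ‖oseenKernel (σa / 2) y a b‖
      ≤ C * ∫ y, Real.exp (-‖z - y‖ ^ 2 / (8 * (σb - σa / 2))) *
          (C₀ * (σa / 2 + ‖y‖ ^ 2) ^ (-(((Module.finrank ℝ E : ℝ) + 1) / 2)) * ‖a‖ * ‖b‖) := by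
        refine mul_le_mul_of_nonneg_left (integral_mono_of_nonneg
          (Eventually.of_forall fun y => by positivity) hint (Eventually.of_forall fun y => ?_)) hC
        exact mul_le_mul_of_nonneg_left (hK hσ₁ y a b) (Real.exp_pos _).le
    _ = C * C₀ * ‖a‖ * ‖b‖ * oseenKernelPotential (σa / 2) (8 * (σb - σa / 2)) z := by
        rw [oseenKernelPotential, show C * C₀ * ‖a‖ * ‖b‖ = C * (C₀ * ‖a‖ * ‖b‖) by ring, mul_assoc,
          ← integral_const_mul (C₀ * ‖a‖ * ‖b‖)]
        congr 1
        refine integral_congr_ae (Eventually.of_forall fun y => ?_)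
        ring

/-- **Gaussian-potential bound for the joint derivatives of the operator-valued kernel**:
`‖D^m_{(σ,z)} K(σ, z)‖ ≤ C P(z)` on `[σ_a, σ_b] × E`. [folklore] -/
theorem exists_norm_iteratedFDeriv_oseenKernelCLM_prod_le (m : ℕ) {σa σb : ℝ} (hσa : 0 < σa)
    (hab : σa ≤ σb) :
    ∃ C : ℝ, 0 ≤ C ∧ ∀ σ ∈ Icc σa σb, ∀ z : E,
      ‖iteratedFDeriv ℝ m (fun r : ℝ × E => oseenKernelCLM r.1 r.2) (σ, z)‖ ≤
        C * oseenKernelPotential (σa / 2) (8 * (σb - σa / 2)) z := by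
  obtain ⟨C, hC, hb⟩ := exists_norm_iteratedFDeriv_oseenKernel_prod_le (E := E) m hσa hab
  refine ⟨C, hC, fun σ hσ z => ?_⟩
  have hq : ((σ, z) : ℝ × E) ∈ Ioi (0 : ℝ) ×ˢ (univ : Set E) := mk_mem_prod (hσa.trans_le hσ.1) (mem_univ _)
  have hP := oseenKernelPotential_nonneg (half_pos hσa).le (8 * (σb - σa / 2)) z
  refine ContinuousMultilinearMap.opNorm_le_bound (by positivity) fun V => ?_
  refine ContinuousLinearMap.opNorm_le_bound _ (by positivity) fun a => ?_
  refine ContinuousLinearMap.opNorm_le_bound _ (by positivity) fun b => ?_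
  rw [iteratedFDeriv_oseenKernelCLM_prod_apply m hq V a b]
  calc ‖iteratedFDeriv ℝ m (fun r : ℝ × E => oseenKernel r.1 r.2 a b) (σ, z) V‖
      ≤ ‖iteratedFDeriv ℝ m (fun r : ℝ × E => oseenKernel r.1 r.2 a b) (σ, z)‖ * ∏ i, ‖V i‖ :=
        ContinuousMultilinearMap.le_opNorm _ _
    _ ≤ (C * ‖a‖ * ‖b‖ * oseenKernelPotential (σa / 2) (8 * (σb - σa / 2)) z) * ∏ i, ‖V i‖ :=
        mul_le_mul_of_nonneg_right (hb σ hσ z a b) (Finset.prod_nonneg fun _ _ => norm_nonneg _)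
    _ = C * oseenKernelPotential (σa / 2) (8 * (σb - σa / 2)) z * (∏ i, ‖V i‖) * ‖a‖ * ‖b‖ := by ring

/-- **Uniform bound for the joint derivatives on compact ranges**: `‖D^m K(σ, z)‖ ≤ C` for
`σ ∈ [σ_a, σ_b]`, all `z` (the potential of the bounded envelope is bounded). [folklore] -/
theorem exists_norm_iteratedFDeriv_oseenKernelCLM_prod_le_const (m : ℕ) {σa σb : ℝ} (hσa : 0 < σa)
    (hab : σa ≤ σb) :
    ∃ C : ℝ, 0 ≤ C ∧ ∀ σ ∈ Icc σa σb, ∀ z : E,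
      ‖iteratedFDeriv ℝ m (fun r : ℝ × E => oseenKernelCLM r.1 r.2) (σ, z)‖ ≤ C := by
  have hσ₁ : 0 < σa / 2 := half_pos hσa
  have hc : 0 < 8 * (σb - σa / 2) := by linarith
  obtain ⟨C, hC, hb⟩ := exists_norm_iteratedFDeriv_oseenKernelCLM_prod_le (E := E) m hσa hab
  set B : ℝ := (σa / 2) ^ (-(((Module.finrank ℝ E : ℝ) + 1) / 2)) *
    ∫ w : E, Real.exp (-‖w‖ ^ 2 / (8 * (σb - σa / 2))) with hB
  have hB0 : 0 ≤ B := mul_nonneg (Real.rpow_nonneg hσ₁.le _) (integral_nonneg fun w => (Real.exp_pos _).le)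
  exact ⟨C * B, by positivity, fun σ hσ z =>
    (hb σ hσ z).trans (mul_le_mul_of_nonneg_left (oseenKernelPotential_le hσ₁ hc z) hC)⟩

end Bounds

/-! ### Gaussian potentials of integrable functions -/

section Potential

variable {F : Type*} [NormedAddCommGroup F]

/-- **Gaussian potentials of integrable functions are integrable, with the product of the
masses**: for `g ∈ L¹` and `c > 0`, `z ↦ ∫ e^{-‖z-y‖²/c} ‖g(y)‖ dy` is integrable with integral
`(∫ e^{-‖w‖²/c} dw) ‖g‖₁` (Tonelli, through Mathlib's `integral_convolution`). [folklore] -/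
theorem integrable_gaussianPotential {g : E → F} (hg : Integrable g) {c : ℝ} (hc : 0 < c) :
    Integrable (fun z : E => ∫ y, Real.exp (-‖z - y‖ ^ 2 / c) * ‖g y‖) ∧
      ∫ z, (∫ y, Real.exp (-‖z - y‖ ^ 2 / c) * ‖g y‖) =
        (∫ w : E, Real.exp (-‖w‖ ^ 2 / c)) * ∫ y, ‖g y‖ := by
  have hG := integrable_exp_neg_norm_sq_div (E := E) hc
  -- the potential is the convolution `‖g‖ ⋆ G`
  have hconv : (fun z : E => ∫ y, Real.exp (-‖z - y‖ ^ 2 / c) * ‖g y‖) =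
      ((fun y => ‖g y‖) ⋆[ContinuousLinearMap.mul ℝ ℝ, volume] fun w : E => Real.exp (-‖w‖ ^ 2 / c)) := by
    funext z
    rw [convolution_def]
    refine integral_congr_ae (Eventually.of_forall fun y => ?_)
    simp only [ContinuousLinearMap.mul_apply']
    ring
  rw [hconv]
  refine ⟨hg.norm.integrable_convolution _ hG, ?_⟩
  rw [integral_convolution _ hg.norm hG, ContinuousLinearMap.mul_apply', mul_comm]

omit [InnerProductSpace ℝ E] [FiniteDimensional ℝ E] [MeasurableSpace E] [BorelSpace E] in
/-- Gaussian comparison on a unit ball, general variance: for `‖e‖ ≤ 1`,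
`e^{-‖z + e - y‖²/c} ≤ e^{2/c} e^{-‖z - y‖²/(2c)}`. [folklore] -/
theorem exp_neg_norm_add_sub_sq_le [NormedSpace ℝ E] {c : ℝ} (hc : 0 < c) {e : E} (he : ‖e‖ ≤ 1)
    (z y : E) :
    Real.exp (-‖z + e - y‖ ^ 2 / c) ≤ Real.exp (2 / c) * Real.exp (-‖z - y‖ ^ 2 / (2 * c)) := by
  rw [← Real.exp_add, Real.exp_le_exp, ← sub_nonpos]
  have htri : ‖z - y‖ ≤ ‖z + e - y‖ + ‖e‖ := by
    calc ‖z - y‖ = ‖(z + e - y) - e‖ := by congr 1; abel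
      _ ≤ ‖z + e - y‖ + ‖e‖ := norm_sub_le _ _
  have hb : ‖z - y‖ ≤ ‖z + e - y‖ + 1 := by linarith
  have hsq : ‖z - y‖ ^ 2 ≤ 2 * ‖z + e - y‖ ^ 2 + 2 := by
    have h2 : ‖z - y‖ ^ 2 ≤ (‖z + e - y‖ + 1) ^ 2 := pow_le_pow_left₀ (norm_nonneg _) hb 2
    nlinarith [sq_nonneg (‖z + e - y‖ - 1)]
  have key : -‖z + e - y‖ ^ 2 / c - (2 / c + -‖z - y‖ ^ 2 / (2 * c)) =
      (‖z - y‖ ^ 2 - 2 * ‖z + e - y‖ ^ 2 - 4) / (2 * c) := by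
    field_simp
    ring
  rw [key]
  exact div_nonpos_of_nonpos_of_nonneg (by linarith) (by positivity)

/-- **Suprema of Gaussian potentials over unit balls are integrable**: for `g ∈ L¹`, `c > 0`,
the function `z ↦ e^{2/c} ∫ e^{-‖z-y‖²/(2c)} ‖g(y)‖ dy` is integrable and dominates
`∫ e^{-‖z + e - y‖²/c} ‖g(y)‖ dy` for every `‖e‖ ≤ 1` (the dominating functions for
differentiation under the integral sign in a space variable). [folklore] -/
theorem integrable_gaussianPotential_ball {g : E → F} (hg : Integrable g) {c : ℝ} (hc : 0 < c) :
    Integrable (fun z : E => Real.exp (2 / c) * ∫ y, Real.exp (-‖z - y‖ ^ 2 / (2 * c)) * ‖g y‖) ∧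
      ∀ (z e : E), ‖e‖ ≤ 1 →
        ∫ y, Real.exp (-‖z + e - y‖ ^ 2 / c) * ‖g y‖ ≤
          Real.exp (2 / c) * ∫ y, Real.exp (-‖z - y‖ ^ 2 / (2 * c)) * ‖g y‖ := by
  have h2c : 0 < 2 * c := by positivity
  obtain ⟨hint, -⟩ := integrable_gaussianPotential hg h2c
  refine ⟨hint.const_mul _, fun z e he => ?_⟩
  have hiz := integrable_exp_neg_norm_sub_sq_div_mul hg h2c z
  rw [← integral_const_mul]
  refine integral_mono_of_nonneg (Eventually.of_forall fun y => by positivity) (hiz.const_mul _)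
    (Eventually.of_forall fun y => ?_)
  calc Real.exp (-‖z + e - y‖ ^ 2 / c) * ‖g y‖
      ≤ (Real.exp (2 / c) * Real.exp (-‖z - y‖ ^ 2 / (2 * c))) * ‖g y‖ :=
        mul_le_mul_of_nonneg_right (exp_neg_norm_add_sub_sq_le hc he z y) (norm_nonneg _)
    _ = _ := by ring

end Potential

/-! ### Consequences for the kernel: the potential, `L¹` control, unit-ball envelopes -/

section KernelL1

/-- The kernel potential is the Gaussian potential of the (nonnegative, integrable) envelope.
[folklore] -/
theorem oseenKernelPotential_eq {σ₁ : ℝ} (hσ₁ : 0 ≤ σ₁) (c : ℝ) (z : E) :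
    oseenKernelPotential σ₁ c z = ∫ y, Real.exp (-‖z - y‖ ^ 2 / c) *
      ‖(σ₁ + ‖y‖ ^ 2) ^ (-(((Module.finrank ℝ E : ℝ) + 1) / 2))‖ := by
  refine integral_congr_ae (Eventually.of_forall fun y => ?_)
  dsimp only
  rw [Real.norm_of_nonneg (Real.rpow_nonneg (by positivity) _)]

/-- **The kernel potential is integrable in `z`** (`σ₁ > 0`, `c > 0`). [folklore] -/
theorem integrable_oseenKernelPotential {σ₁ c : ℝ} (hσ₁ : 0 < σ₁) (hc : 0 < c) :
    Integrable (oseenKernelPotential (E := E) σ₁ c) := by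
  have h := (integrable_gaussianPotential (integrable_oseenEnvelope (E := E) hσ₁) hc).1
  refine h.congr (Eventually.of_forall fun z => ?_)
  exact (oseenKernelPotential_eq hσ₁.le c z).symm

/-- **Unit-ball envelopes of the kernel potential**: `P_c(z + e) ≤ e^{2/c} P_{2c}(z)` for `‖e‖ ≤ 1`
(and `P_{2c}` is integrable): the dominating functions when a space variable ranges over a unit
ball. [folklore] -/
theorem oseenKernelPotential_add_le {σ₁ c : ℝ} (hσ₁ : 0 < σ₁) (hc : 0 < c) (z e : E) (he : ‖e‖ ≤ 1) :
    oseenKernelPotential σ₁ c (z + e) ≤ Real.exp (2 / c) * oseenKernelPotential σ₁ (2 * c) z := by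
  have h := (integrable_gaussianPotential_ball (integrable_oseenEnvelope (E := E) hσ₁) hc).2 z e he
  rw [oseenKernelPotential_eq hσ₁.le, oseenKernelPotential_eq hσ₁.le]
  exact h

/-- **`L¹` bound for the joint derivatives of the kernel on compact ranges**: for every `m` and
`[σ_a, σ_b] ⊂ (0, ∞)` there is `C ≥ 0` with `∫ ‖D^m_{(σ,z)}K(σ, z)‖ dz ≤ C` for `σ ∈ [σ_a, σ_b]`,
and the derivative is integrable in `z`. [folklore] -/
theorem exists_integral_norm_iteratedFDeriv_oseenKernelCLM_prod_le (m : ℕ) {σa σb : ℝ}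
    (hσa : 0 < σa) (hab : σa ≤ σb) :
    ∃ C : ℝ, 0 ≤ C ∧ ∀ σ ∈ Icc σa σb,
      Integrable (fun z : E => iteratedFDeriv ℝ m (fun r : ℝ × E => oseenKernelCLM r.1 r.2) (σ, z)) ∧
      ∫ z, ‖iteratedFDeriv ℝ m (fun r : ℝ × E => oseenKernelCLM r.1 r.2) (σ, z)‖ ≤ C := by
  have hσ₁ : 0 < σa / 2 := half_pos hσa
  obtain ⟨C, hC, hb⟩ := exists_norm_iteratedFDeriv_oseenKernelCLM_prod_le (E := E) m hσa hab
  have hc : 0 < 8 * (σb - σa / 2) := by linarith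
  have hPint := integrable_oseenKernelPotential (E := E) hσ₁ hc
  set P : E → ℝ := oseenKernelPotential (σa / 2) (8 * (σb - σa / 2)) with hP
  refine ⟨C * ∫ z, P z, mul_nonneg hC (integral_nonneg fun z => oseenKernelPotential_nonneg hσ₁.le _ z),
    fun σ hσ => ?_⟩
  have hmeas : AEStronglyMeasurable
      (fun z : E => iteratedFDeriv ℝ m (fun r : ℝ × E => oseenKernelCLM r.1 r.2) (σ, z)) volume := by
    refine ((continuousOn_iteratedFDeriv_oseenKernelCLM_prod (E := E) m).comp_continuous
      (by fun_prop) fun z => mk_mem_prod (hσa.trans_le hσ.1) (mem_univ _)).aestronglyMeasurable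
  have hdom : ∀ z, ‖iteratedFDeriv ℝ m (fun r : ℝ × E => oseenKernelCLM r.1 r.2) (σ, z)‖ ≤ C * P z :=
    fun z => hb σ hσ z
  have hint : Integrable (fun z : E => iteratedFDeriv ℝ m (fun r : ℝ × E => oseenKernelCLM r.1 r.2) (σ, z)) :=
    (hPint.const_mul C).mono' hmeas (Eventually.of_forall hdom)
  refine ⟨hint, ?_⟩
  calc ∫ z, ‖iteratedFDeriv ℝ m (fun r : ℝ × E => oseenKernelCLM r.1 r.2) (σ, z)‖
      ≤ ∫ z, C * P z := integral_mono_of_nonneg (Eventually.of_forall fun _ => norm_nonneg _)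
        (hPint.const_mul C) (Eventually.of_forall hdom)
    _ = C * ∫ z, P z := integral_const_mul _ _

end KernelL1

end Literature.Analysis.FluidPDE

end
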